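import Mathlib.RepresentationTheory.Maschke
import Mathlib.RingTheory.Jacobson.Semiprimary
import Mathlib.FieldTheory.Finite.Basic
import Mathlib.RingTheory.SimpleRing.Basic
import Mathlib.RingTheory.SimpleModule.Basic
import Mathlib.RingTheory.Nilpotent.Defs
import Mathlib.Algebra.MonoidAlgebra.Basic
import Mathlib.Data.ZMod.Basic
import HarnessLib

/-!
# The semisimple ring `𝔽_q[ℤ/g]` of the plus argument: complements of ideals and coordinate vectors

[Schoof2009, Theorem 14.1] works in the group ring `𝔽_q[G⁺]`, `G⁺ = Gal(ℚ(ζ_p)⁺/ℚ) ≅ ℤ/g`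
(`g = (p-1)/2`), which is **semisimple** when `q ∤ g` ([Schoof2009, Proposition 13.1], Maschke), so
that "every exact sequence of `𝔽_q[G⁺]`-modules splits" and ideals have complements.  This file
provides the two pieces of pure algebra used by our `K`-language version of the argument, for the
ring `A = MonoidAlgebra (ZMod q) (Multiplicative (ZMod g))`:

* `Catalan.PlusRing.exists_mem_ne_zero_forall_mul_eq_zero` — in a commutative semisimple ring, for
  ideals `J < I` there is `f ∈ I`, `f ≠ 0`, with `f · J = 0` (a nonzero element of a complement of `J`
  inside `I`; this is how the nonvanishing of the annihilator of `E₁ × E₃` in [Schoof2009, p. 93] is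
  used);
* the **coordinate vectors** `toR v = ∑_k v_k [k] ∈ A` of functions `v : ℤ/g → 𝔽_q`
  (parameter `toR` pinned down by `htoR : (toR v).coeff x = v (toAdd x)`; no definition is
  introduced): additivity, injectivity, and `[j] · toR v = toR (v(· - j))`,
  `f · toR v = ∑_k f_k • toR (v(· - k))` — the regular representation of `ℤ/g`.

## References

* R. Schoof, *Catalan's Conjecture*, Universitext, Springer 2009, Proposition 13.1 and Theorem 14.1
  (proof, p. 93). [Schoof2009]
-/

namespace Literature.NumberTheory.DiophantineGeometry

namespace Catalan.PlusRing

/-! ### Complements in commutative semisimple rings -/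

/-- **Nonzero annihilating elements from complements.**  In a commutative semisimple ring, if `J < I`
are ideals then some `f ∈ I ∖ {0}` satisfies `f · J = 0`: write `I ∋ x ∉ J` as `x = j + j'` along a
complement `J ⊕ J' = A`; then `f = j' = x - j ∈ I`, `f ≠ 0`, and `f J ⊆ J' ∩ J = 0`.
[cite: Schoof2009, Proposition 13.1 ("every exact sequence … splits") and Theorem 14.1 (proof, p. 93)] -/
theorem exists_mem_ne_zero_forall_mul_eq_zero {A : Type*} [CommRing A] [IsSemisimpleRing A]
    {I J : Ideal A} (hJI : J < I) : ∃ f ∈ I, f ≠ 0 ∧ ∀ x ∈ J, f * x = 0 := by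
  obtain ⟨J', hJJ'⟩ := exists_isCompl (J : Submodule A A)
  obtain ⟨x, hxI, hxJ⟩ := SetLike.exists_of_lt hJI
  -- decompose `x = j + j'`
  have hx : x ∈ (J : Submodule A A) ⊔ J' := by rw [hJJ'.sup_eq_top]; exact Submodule.mem_top
  obtain ⟨j, hj, j', hj', hjj'⟩ := Submodule.mem_sup.mp hx
  refine ⟨j', ?_, ?_, fun y hy => ?_⟩
  · have : j' = x - j := by rw [← hjj', add_sub_cancel_left]
    rw [this]
    exact I.sub_mem hxI (hJI.le hj)
  · rintro rfl
    rw [add_zero] at hjj'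
    exact hxJ (hjj' ▸ hj)
  · have h1 : j' * y ∈ (J' : Submodule A A) := by
      rw [mul_comm]
      exact J'.smul_mem y hj'
    have h2 : j' * y ∈ (J : Submodule A A) := J.mul_mem_left j' hy
    have h3 : j' * y ∈ (J : Submodule A A) ⊓ J' := ⟨h2, h1⟩
    rw [hJJ'.inf_eq_bot] at h3
    exact h3

/-! ### `𝔽_q[ℤ/g]` is semisimple and reduced for `q ∤ g` -/

/-- `q ∤ g` makes `#(ℤ/g)` nonzero in `𝔽_q` (hypothesis of Maschke's theorem). [cite: Schoof2009, Proposition 13.1] -/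
theorem neZero_card_multiplicative {g q : ℕ} [NeZero g] [Fact q.Prime] (hqg : ¬ q ∣ g) :
    NeZero ((Nat.card (Multiplicative (ZMod g)) : ℕ) : ZMod q) := by
  refine ⟨fun h => hqg ?_⟩
  rw [Nat.card_eq_fintype_card, Fintype.card_multiplicative, ZMod.card] at h
  exact (ZMod.natCast_eq_zero_iff _ _).mp h

/-- **`𝔽_q[ℤ/g]` is semisimple** for `q ∤ g` ([Schoof2009, Proposition 13.1]; Mathlib's Maschke
theorem). [cite: Schoof2009, Proposition 13.1] -/
theorem isSemisimpleRing {g q : ℕ} [NeZero g] [Fact q.Prime] (hqg : ¬ q ∣ g) :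
    IsSemisimpleRing (MonoidAlgebra (ZMod q) (Multiplicative (ZMod g))) := by
  haveI := neZero_card_multiplicative (g := g) (q := q) hqg
  infer_instance

/-- `𝔽_q[ℤ/g]` is reduced for `q ∤ g`. [cite: Schoof2009, Proposition 13.1] -/
theorem isReduced {g q : ℕ} [NeZero g] [Fact q.Prime] (hqg : ¬ q ∣ g) :
    IsReduced (MonoidAlgebra (ZMod q) (Multiplicative (ZMod g))) := by
  haveI := neZero_card_multiplicative (g := g) (q := q) hqg
  infer_instance

/-! ### Coordinate vectors `toR v = ∑_k v_k [k]` -/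

section ToR

variable {g q : ℕ}
variable (toR : (ZMod g → ZMod q) → MonoidAlgebra (ZMod q) (Multiplicative (ZMod g)))
  (htoR : ∀ v x, (toR v).coeff x = v (Multiplicative.toAdd x))

include htoR in
/-- `toR` is additive. [folklore] -/
theorem toR_add (v w : ZMod g → ZMod q) : toR (v + w) = toR v + toR w := by
  apply MonoidAlgebra.coeff_inj.mp
  ext x
  rw [MonoidAlgebra.coeff_add, Finsupp.add_apply, htoR, htoR, htoR, Pi.add_apply]

include htoR in
/-- `toR 0 = 0`. [folklore] -/
theorem toR_zero : toR 0 = 0 := by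
  apply MonoidAlgebra.coeff_inj.mp
  ext x
  rw [htoR, Pi.zero_apply, MonoidAlgebra.coeff_zero, Finsupp.zero_apply]

include htoR in
/-- `toR` is `𝔽_q`-linear. [folklore] -/
theorem toR_smul (c : ZMod q) (v : ZMod g → ZMod q) : toR (c • v) = c • toR v := by
  apply MonoidAlgebra.coeff_inj.mp
  ext x
  rw [MonoidAlgebra.coeff_smul, Finsupp.smul_apply, htoR, htoR, Pi.smul_apply]

include htoR in
/-- `toR` of natural multiples. [folklore] -/
theorem toR_nsmul (n : ℕ) (v : ZMod g → ZMod q) : toR (n • v) = n • toR v := by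
  induction n with
  | zero => rw [zero_smul, zero_smul, toR_zero toR htoR]
  | succ n ih => rw [succ_nsmul, succ_nsmul, toR_add toR htoR, ih]

include htoR in
/-- `toR` of finite sums. [folklore] -/
theorem toR_sum {ι : Type*} (s : Finset ι) (v : ι → ZMod g → ZMod q) :
    toR (∑ i ∈ s, v i) = ∑ i ∈ s, toR (v i) := by
  classical
  induction s using Finset.induction_on with
  | empty => rw [Finset.sum_empty, Finset.sum_empty, toR_zero toR htoR]
  | insert j s hj ih => rw [Finset.sum_insert hj, Finset.sum_insert hj, toR_add toR htoR, ih]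

include htoR in
/-- `toR` is injective. [folklore] -/
theorem toR_injective : Function.Injective toR := by
  intro v w h
  funext k
  have := congrArg (fun z => z.coeff (Multiplicative.ofAdd k)) h
  simpa [htoR] using this

include htoR in
/-- `toR v = 0 ↔ v = 0`. [folklore] -/
theorem toR_eq_zero_iff (v : ZMod g → ZMod q) : toR v = 0 ↔ v = 0 := by
  rw [← toR_zero toR htoR]
  exact (toR_injective toR htoR).eq_iff

include htoR in
/-- **The regular representation**: `[j] · toR v = toR (v(· - j))`. [cite: Schoof2009, Theorem 14.1 (proof: `E/E^q` is free of rank 1 over `𝔽_q[G⁺]`)] -/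
theorem single_mul_toR (j : ZMod g) (v : ZMod g → ZMod q) :
    MonoidAlgebra.single (Multiplicative.ofAdd j) (1 : ZMod q) * toR v = toR (fun k => v (k - j)) := by
  apply MonoidAlgebra.coeff_inj.mp
  ext x
  rw [MonoidAlgebra.coeff_single_mul_apply, one_mul, htoR, htoR]
  congr 1
  rw [toAdd_mul, toAdd_inv, toAdd_ofAdd, neg_add_eq_sub]

/-- Every element of `𝔽_q[ℤ/g]` is the sum of its monomials: `f = ∑_k f_k [k]`. [folklore] -/
theorem eq_sum_coeff_smul_single (f : MonoidAlgebra (ZMod q) (Multiplicative (ZMod g))) [NeZero g] :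
    f = ∑ k : ZMod g, f.coeff (Multiplicative.ofAdd k) •
      MonoidAlgebra.single (Multiplicative.ofAdd k) (1 : ZMod q) := by
  apply MonoidAlgebra.coeff_inj.mp
  ext x
  rw [MonoidAlgebra.coeff_sum, Finset.sum_apply']
  simp_rw [MonoidAlgebra.coeff_smul, Finsupp.smul_apply, MonoidAlgebra.coeff_single,
    Finsupp.single_apply, smul_eq_mul, mul_ite, mul_one, mul_zero]
  rw [Finset.sum_eq_single (Multiplicative.toAdd x)]
  · simp
  · intro k _ hk
    rw [if_neg]
    intro h
    apply hk
    rw [← h, toAdd_ofAdd]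
  · intro h
    exact absurd (Finset.mem_univ _) h

include htoR in
/-- **`f · toR v = ∑_k f_k • toR (v(· - k))`**: multiplication by `f` in terms of shifts.
[cite: Schoof2009, Theorem 14.1 (proof)] -/
theorem mul_toR [NeZero g] (f : MonoidAlgebra (ZMod q) (Multiplicative (ZMod g)))
    (v : ZMod g → ZMod q) :
    f * toR v = ∑ k : ZMod g, f.coeff (Multiplicative.ofAdd k) • toR (fun k' => v (k' - k)) := by
  conv_lhs => rw [eq_sum_coeff_smul_single f]
  rw [Finset.sum_mul]
  refine Finset.sum_congr rfl fun k _ => ?_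
  rw [smul_mul_assoc, single_mul_toR toR htoR]

include htoR in
/-- The same with the shifts written through `toR` of an explicit vector:
`f · toR v = toR (∑_k f_k • v(· - k))`. [folklore] -/
theorem mul_toR' [NeZero g] (f : MonoidAlgebra (ZMod q) (Multiplicative (ZMod g)))
    (v : ZMod g → ZMod q) :
    f * toR v = toR (∑ k : ZMod g, f.coeff (Multiplicative.ofAdd k) • fun k' => v (k' - k)) := by
  rw [mul_toR toR htoR, toR_sum toR htoR]
  exact Finset.sum_congr rfl fun k _ => (toR_smul toR htoR _ _).symm

end ToR

end Catalan.PlusRing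

end Literature.NumberTheory.DiophantineGeometry
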